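import Summits.QuantumFields.YangMills.Theorems.FluctuationComparisonRegPrIntLS2BetaFlatTubeTowerStep
import HarnessLib

/-!
# CLOSE-PAIR IN `ℓ²` AT EVERY DEPTH, VOLUME-UNIFORM — two good histories over the SAME datum are `ℓ²`-close modulo a residual transformation, with the sum of their ACTIONS on
# the right and a constant `C(L, K − J)` chosen before the family and the run (the pair edition of ✓`…S2BetaFlatTubeTowerStep.flat_tower`)
# (crux `FluctuationComparisonRegPrIntL`, stmt-QuantumFields-20520; registry v11.4 `Cruxes/FluctuationComparisonRegPrIntL/Lines/semiclassical_s2beta.lean` 3732b7df FROZEN, untouched)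

Cell `ym3-torus` (YM ladder rung R3 = continuum `SU(2)` Yang–Mills on the three-torus — a RUNG: NOT d = 4, NOT infinite volume, NOT a mass gap, NOT Clay).
Width seat `ym3-torus-px12` (gen 22); `--kind proof --supports stmt-QuantumFields-20520 --as helper`, count-neutral, DEFINITION-FREE (0 `def`, 0 `instance`,
0 `notation`, 0 `sorry`, default heartbeats).

WHY.  px8 g18's ✓`closePair_holds` (CLOSE-PAIR∘, [Balaban1985RegularSpaces] Lemma 1 iterated, [Balaban1985UV3] (12)–(13)) is a SUP statement with THRESHOLDS on the right: two good
histories over one datum are `δ`-close bondwise once `γ ≤ γ₁(δ)`.  The growth organs measure `ℓ²` distances to residual orbits with ACTIONS on the right and constants chosen before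
the run.  This file is the `ℓ²`∕action edition: the induction over runs of ✓`flat_tower` with the pure gauge `g • 1` replaced by `g • U′` — the one-level pair bound
✓`…S2BetaOneStepL2ClosePair.sum_dist1_mul_inv_sq_le` pays the previous depth's deviation as the (0.4)-mismatch channel and `4(A(U) + A(U′))` as the plaquette channel, and
✓`…S2BetaOneStepL2ActionOfAverage.wilsonAction4_avg_le` bounds the descended actions.

WHAT (d = 3 carrier, `SU(2)`, `ℰp`).
* §1 `sum_sq_mismatch_pair_eq` (the mismatch channel against the lifted `w′ ∘ σ⁻¹ • Ū′` IS the deviation `Σ dist1((D U) ℓ′·((w′ • D U′) ℓ′)⁻¹)²` one run down), `sum_ball_pair_le_of_plaqSmall`.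
* §2 ★★ `pair_tower` — for `θ` under the guards: `∀ m K J (K − J = m) V`, every two fields `U, U′ ∈ fibre_{J,K}(V)` all of whose descended fields are `θ`-small admit a RESIDUAL `w`
  with `Σ_ℓ dist1(U ℓ·((w • U′) ℓ)⁻¹)² ≤ β(L)(α(L)+1)^m·(A(U) + A(U′))`.

HONEST: `C(L, m)` grows geometrically in the depth; lattice kinematics + Cauchy–Schwarz; nothing of Bałaban's analysis; CLOSE-PAIR∘ (sup) is px8's and NOT re-proved; TUBE-REG∘, GAP♯∘,
EXW∘, S2β, crux 20520 NOT proved; no registered stub is closed; rung R3 = SU(2) YM₃ on T³ — NOT d = 4, NOT infinite volume, NOT a mass gap, NOT Clay; the Yang–Mills mass gap is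
NOT proved.  Sorry-free, axioms standard.

References: T. Bałaban, CMP **99** (1985) 75–102 [Balaban1985RegularSpaces] (Lemma 1 (1.24)–(1.26) pp.79–80); CMP **102** (1985) 255–275 [Balaban1985UV3] ((11) p.258, (12)–(13)
p.259); CMP **109** (1987) 249–301 [Balaban1987RG1] ((0.4), (0.11) p.253).
-/

set_option autoImplicit false

noncomputable section

namespace Summit.QuantumFields.YangMills.Theorems.FluctuationComparisonRegPrIntLS2BetaClosePairL2Tower

open Finset
open Literature.MathematicalPhysics.QuantumFieldTheory.Balaban1983to89
open T4Continuum BlockAveraging AveragingRT ExpMeanLog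
open T3ContinuumYM3Torus
open T3UnitLawDensityEML (ℰp)
open T3UnitScaleTilt T3TiltDescent T3LevelShift
open T3ConstrainedMinimiser (fibre)
open T3PrintedRegularMinimiser
open T3DescentFibreTower (descendTo_descendTo descendTo_self)
open T3OneStepAveragingPlaquettes (descendTo_succ)
open B10Eq27TorusAxialLog (axialT gaugeActT gaugeActT_eq_gaugeAct)
open B5Eq118OneStroke (iterBlockOf)
open B15DeterminingSets (embIter)
open Summit.QuantumFields.YangMills.Theorems.Prop7AxialGauge (exists_axialGauge)
open Summit.QuantumFields.YangMills.Theorems.FluctuationComparisonRegPrIntLS2BetaFlatTubeDepthOneUniformTorus (sum_dist1_sq_plaq_le_four_mul_wilsonAction4)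
open Summit.QuantumFields.YangMills.Theorems.FluctuationComparisonRegPrIntLS2BetaFlatTubeDepthOneUniform (sum_ball_gaugeAct sum_ball_le_of_plaqSmall)
open Summit.QuantumFields.YangMills.Theorems.FluctuationComparisonRegPrIntLS2BetaOneStepL2ClosePair (sum_dist1_mul_inv_sq_le)
open Summit.QuantumFields.YangMills.Theorems.FluctuationComparisonRegPrIntLS2BetaOneStepL2ActionOfAverage (wilsonAction4_avg_le)
open Summit.QuantumFields.YangMills.Theorems.FluctuationComparisonRegPrIntLS2BetaFlatTubeTowerStep (sum_near_le_of_plaqSmall step_arith)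

open scoped Matrix.Norms.L2Operator

variable (F : T3Family)

/-! ## §1 Transports -/

/-- **THE PAIR MISMATCH CHANNEL IS THE COARSE PAIR DEVIATION**: `Σ_c dist1(Ū c·((w′∘σ⁻¹ • Ū′) c)⁻¹)² = Σ_{ℓ′} dist1((D U) ℓ′·((w′ • D U′) ℓ′)⁻¹)²` (✓`descendTo_succ`, `bondShift`).
[cite: Balaban1987RG1, (0.11) p.253] -/
theorem sum_sq_mismatch_pair_eq (K : ℕ) (U Z : GaugeField (F.P (K + 1)) 0 (Matrix.specialUnitaryGroup (Fin 2) ℂ)) (w' : Site (F.P K) 0 → (Matrix.specialUnitaryGroup (Fin 2) ℂ)) :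
    ∑ c : PBond (F.P (K + 1)) 1, dist1 (avgFun ℰp U c *
        ((GaugeField.gaugeAct (fun y : Site (F.P (K + 1)) 1 =>
          w' ((siteShift (F.sitesPerDir_eq (m := F.m) (K := K) (j := 0) (m' := F.m) (K' := K + 1) (j' := 1) (by omega))).symm y))
          (avgFun ℰp Z)) c)⁻¹) ^ 2 =
      ∑ ℓ : PBond (F.P K) 0, dist1 (descendTo F ℰp K (K + 1) (Nat.le_succ K) U ℓ *
        ((GaugeField.gaugeAct w' (descendTo F ℰp K (K + 1) (Nat.le_succ K) Z)) ℓ)⁻¹) ^ 2 := by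
  set h := F.sitesPerDir_eq (m := F.m) (K := K) (j := 0) (m' := F.m) (K' := K + 1) (j' := 1) (by omega) with hh
  rw [descendTo_succ, descendTo_succ]
  symm
  refine Fintype.sum_equiv (bondShift h) _ _ fun ℓ => ?_
  have h1 : (GaugeField.gaugeAct w' (fieldShift h (avgFun ℰp Z))) ℓ =
      (GaugeField.gaugeAct (fun y : Site (F.P (K + 1)) 1 => w' ((siteShift h).symm y)) (avgFun ℰp Z)) (bondShift h ℓ) := by
    show w' ℓ.src * (avgFun ℰp Z) (bondShift h ℓ) * (w' ℓ.tgt)⁻¹ =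
      w' ((siteShift h).symm (bondShift h ℓ).src) * (avgFun ℰp Z) (bondShift h ℓ) * (w' ((siteShift h).symm (bondShift h ℓ).tgt))⁻¹
    rw [bondShift_tgt, bondShift_src, Equiv.symm_apply_apply, Equiv.symm_apply_apply]
  rw [fieldShift_apply, blockAvg_avg, h1]
  rfl

/-- A pair's ball square sum under `PlaqSmall θ` (both fields): `≤ 2·d²(2R+1)^d·θ²`. [cite: Balaban1987RG1, (0.18) p.255] -/
theorem sum_ball_pair_le_of_plaqSmall {P : Params} {G : Type*} [GaugeGroup G] (U Z : GaugeField P 0 G) {θ : ℝ} (hU : PlaqSmall θ U) (hZ : PlaqSmall θ Z)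
    (c : Site P 0) (R : ℕ) :
    ∑ q ∈ univ.filter (fun q : Plaq P 0 => Site.tdist q.src c ≤ R), (dist1 (GaugeField.plaqHol U q) ^ 2 + dist1 (GaugeField.plaqHol Z q) ^ 2) ≤
      (2 * ((P.d ^ 2 * (2 * R + 1) ^ P.d : ℕ) : ℝ)) * θ ^ 2 := by
  rw [Finset.sum_add_distrib]
  have h1 := sum_ball_le_of_plaqSmall U hU c R
  have h2 := sum_ball_le_of_plaqSmall Z hZ c R
  linarith

/-! ## §2 The induction down the tower, pair edition -/

/-- ★★ **THE PAIR TOWER.**  Fix `θ ≥ 0` under the two guards.  For every depth `m`, every `J ≤ K` with `K − J = m`, every datum `V` and every two fields `U, U′` of run `K` in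
`fibre_{J,K}(V)` all of whose descended fields `D_{i,K}` (`J ≤ i ≤ K`) have plaquettes `< θ`: a RESIDUAL `w` (`D_{J,K}(w • ·) = D_{J,K}`) with
`Σ_ℓ dist1(U ℓ·((w • U′) ℓ)⁻¹)² ≤ β(L)(α(L)+1)^m·(A(U) + A(U′))`. [cite: Balaban1985RegularSpaces, Lemma 1 (1.24)-(1.26) pp.79-80; Balaban1985UV3, (12)-(13) p.259; Balaban1987RG1, (0.11) p.253] -/
theorem pair_tower {θ : ℝ} (hθ0 : 0 ≤ θ)
    (hθ1 : ∀ K : ℕ, Real.sqrt (2 * (((F.P K).d ^ 2 * (2 * (2 * (F.P K).d * (F.P K).L + (F.P K).L) + 1) ^ (F.P K).d : ℕ) : ℝ)) * θ < (deltaSU (Fin 2) / (((((F.P K).d + 2) * (F.P K).L : ℕ) : ℝ) ^ 2 / 4)))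
    (hθ2 : ∀ K : ℕ, Real.sqrt (((F.P K).d ^ 2 * (2 * ((F.P K).d * (F.P K).L) + 1) ^ (F.P K).d * (2 * (F.P K).d + 1) ^ (F.P K).d : ℕ) : ℝ) * θ < (deltaSU (Fin 2) / (((((F.P K).d + 2) * (F.P K).L : ℕ) : ℝ) ^ 2 / 4))) :
    ∀ (m K J : ℕ) (hJK : J ≤ K), K - J = m → ∀ (V : GaugeField (F.P J) 0 (Matrix.specialUnitaryGroup (Fin 2) ℂ)) (U Z : GaugeField (F.P K) 0 (Matrix.specialUnitaryGroup (Fin 2) ℂ)),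
      U ∈ fibre F ℰp J K hJK V → Z ∈ fibre F ℰp J K hJK V →
      (∀ (i : ℕ) (hJi : J ≤ i) (hiK : i ≤ K), PlaqSmall θ (descendTo F ℰp i K hiK U)) →
      (∀ (i : ℕ) (hJi : J ≤ i) (hiK : i ≤ K), PlaqSmall θ (descendTo F ℰp i K hiK Z)) →
      ∃ w : Site (F.P K) 0 → (Matrix.specialUnitaryGroup (Fin 2) ℂ),
        (∀ U'' : GaugeField (F.P K) 0 (Matrix.specialUnitaryGroup (Fin 2) ℂ),
          descendTo F ℰp J K hJK (GaugeField.gaugeAct w U'') = descendTo F ℰp J K hJK U'') ∧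
        ∑ ℓ : PBond (F.P K) 0, dist1 (U ℓ * ((GaugeField.gaugeAct w Z) ℓ)⁻¹) ^ 2 ≤ 8 * ((2 * (((3 : ℕ) : ℝ) * (F.L : ℝ)) ^ 2 + 2 * (6 * ((((3 + 2) * F.L : ℕ) : ℝ) ^ 2 / 4)) + ((3 * ((F.L - 1) / 2) : ℕ) : ℝ) * (4 * (((3 : ℕ) : ℝ) * (F.L : ℝ)) ^ 2 + 2)) ^ 2 * ((3 * (2 * (2 * 3 * F.L + F.L + 3 * F.L) + 1) ^ 3 : ℕ) : ℝ)) * (2 * ((3 * (2 * (3 * F.L) + 1) ^ 3 : ℕ) : ℝ) * (((2 : ℕ) : ℝ) * (((F.L : ℝ) ^ 2 + 6 * (((3 + 2) * F.L : ℕ) : ℝ) ^ 2) ^ 2 * ((3 ^ 2 * (2 * 3 + 1) ^ 3 : ℕ) : ℝ))) + 1) ^ m * (wilsonAction4 U + wilsonAction4 Z) := by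
  intro m
  induction m with
  | zero =>
    intro K J hJK hm V U Z hU hZ _ _
    have hKJ : K = J := by omega
    subst hKJ
    refine ⟨fun _ => 1, fun U'' => by rw [B12RTGaugeInvariance254.gaugeAct_one'], ?_⟩
    have hU1 : U = V := by
      have h := hU
      change descendTo F ℰp K K hJK U = V at h
      rwa [show hJK = le_rfl from rfl, descendTo_self] at h
    have hZ1 : Z = V := by
      have h := hZ
      change descendTo F ℰp K K hJK Z = V at h
      rwa [show hJK = le_rfl from rfl, descendTo_self] at h
    have hZU : Z = U := hZ1.trans hU1.symm
    rw [hZU]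
    have h0 : ∑ ℓ : PBond (F.P K) 0, dist1 (U ℓ * ((GaugeField.gaugeAct (fun _ => (1 : (Matrix.specialUnitaryGroup (Fin 2) ℂ))) U) ℓ)⁻¹) ^ 2 = 0 := by
      refine Finset.sum_eq_zero fun ℓ _ => ?_
      rw [B12RTGaugeInvariance254.gaugeAct_one', mul_inv_cancel, GaugeGroup.dist1_one]; ring
    rw [h0]
    exact mul_nonneg (by positivity) (add_nonneg (wilsonAction4_nonneg _) (wilsonAction4_nonneg _))
  | succ m ih =>
    intro K J hJK hm V U Z hU hZ hsmallU hsmallZ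
    obtain ⟨K₀, rfl⟩ : ∃ K₀, K = K₀ + 1 := ⟨K - 1, by omega⟩
    have hJK₀ : J ≤ K₀ := by omega
    have hm₀ : K₀ - J = m := by omega
    have hk : 1 ≤ (F.P (K₀ + 1)).m + (F.P (K₀ + 1)).K := by show 1 ≤ F.m + (K₀ + 1); omega
    have hd : (F.P (K₀ + 1)).d = 3 := T3Family.P_d F (K₀ + 1)
    have hL : (F.P (K₀ + 1)).L = F.L := rfl
    set h := F.sitesPerDir_eq (m := F.m) (K := K₀) (j := 0) (m' := F.m) (K' := K₀ + 1) (j' := 1) (by omega) with hh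
    -- the descended pair and the induction hypothesis
    set Ud : GaugeField (F.P K₀) 0 (Matrix.specialUnitaryGroup (Fin 2) ℂ) := descendTo F ℰp K₀ (K₀ + 1) (Nat.le_succ K₀) U with hUd
    set Zd : GaugeField (F.P K₀) 0 (Matrix.specialUnitaryGroup (Fin 2) ℂ) := descendTo F ℰp K₀ (K₀ + 1) (Nat.le_succ K₀) Z with hZd
    have hUdf : Ud ∈ fibre F ℰp J K₀ hJK₀ V := by
      show descendTo F ℰp J K₀ hJK₀ (descendTo F ℰp K₀ (K₀ + 1) (Nat.le_succ K₀) U) = V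
      rw [descendTo_descendTo]; exact hU
    have hZdf : Zd ∈ fibre F ℰp J K₀ hJK₀ V := by
      show descendTo F ℰp J K₀ hJK₀ (descendTo F ℰp K₀ (K₀ + 1) (Nat.le_succ K₀) Z) = V
      rw [descendTo_descendTo]; exact hZ
    have hsmallUd : ∀ (i : ℕ) (hJi : J ≤ i) (hiK : i ≤ K₀), PlaqSmall θ (descendTo F ℰp i K₀ hiK Ud) := by
      intro i hJi hiK; rw [hUd, descendTo_descendTo]; exact hsmallU i hJi (by omega)
    have hsmallZd : ∀ (i : ℕ) (hJi : J ≤ i) (hiK : i ≤ K₀), PlaqSmall θ (descendTo F ℰp i K₀ hiK Zd) := by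
      intro i hJi hiK; rw [hZd, descendTo_descendTo]; exact hsmallZ i hJi (by omega)
    obtain ⟨w', hres', hsum'⟩ := ih K₀ J hJK₀ hm₀ V Ud Zd hUdf hZdf hsmallUd hsmallZd
    have hUθ : PlaqSmall θ U := by
      have h1 := hsmallU (K₀ + 1) (by omega) le_rfl
      rwa [descendTo_self] at h1
    have hZθ : PlaqSmall θ Z := by
      have h1 := hsmallZ (K₀ + 1) (by omega) le_rfl
      rwa [descendTo_self] at h1
    -- the lift `g` of `w′`, the partner `Y := g • Z`, the comb-axial gauge of `U` relative to `Y`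
    set g : Site (F.P (K₀ + 1)) 0 → (Matrix.specialUnitaryGroup (Fin 2) ℂ) := fun x => w' ((siteShift h).symm (blockOf x)) with hg
    set Y : GaugeField (F.P (K₀ + 1)) 0 (Matrix.specialUnitaryGroup (Fin 2) ℂ) := GaugeField.gaugeAct g Z with hY
    obtain ⟨v, hv1, hax⟩ := exists_axialGauge (P := F.P (K₀ + 1)) (k := 1) hk Y U
    set W : GaugeField (F.P (K₀ + 1)) 0 (Matrix.specialUnitaryGroup (Fin 2) ℂ) := GaugeField.gaugeAct v U with hW
    have haxW : ∀ x, axialT W (embIter 1 (iterBlockOf 1 x)) x = axialT Y (embIter 1 (iterBlockOf 1 x)) x := by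
      intro x; rw [hW, ← gaugeActT_eq_gaugeAct]; exact hax x
    have hvemb : (fun y : Site (F.P (K₀ + 1)) 1 => v (emb y)) = fun _ => 1 := funext fun y => hv1 y
    have hgemb : (fun y : Site (F.P (K₀ + 1)) 1 => g (emb y)) = fun y => w' ((siteShift h).symm y) := by
      funext y
      have hb : blockOf (emb y) = y := Site.blockOf_emb (show 0 + 1 ≤ (F.P (K₀ + 1)).m + (F.P (K₀ + 1)).K from hk) y
      show w' ((siteShift h).symm (blockOf (emb y))) = w' ((siteShift h).symm y)
      exact congrArg (fun z => w' ((siteShift h).symm z)) hb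
    -- the guard for the pair `(W, Y)`
    have hT : ∀ y : Site (F.P (K₀ + 1)) 1, Real.sqrt (∑ q ∈ univ.filter (fun q : Plaq (F.P (K₀ + 1)) 0 =>
        Site.tdist q.src (emb y) ≤ 2 * (F.P (K₀ + 1)).d * (F.P (K₀ + 1)).L + (F.P (K₀ + 1)).L),
        (dist1 (GaugeField.plaqHol W q) ^ 2 + dist1 (GaugeField.plaqHol Y q) ^ 2)) <
        deltaSU (Fin 2) / (((((F.P (K₀ + 1)).d + 2) * (F.P (K₀ + 1)).L : ℕ) : ℝ) ^ 2 / 4) := by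
      intro y
      have heq : ∑ q ∈ univ.filter (fun q : Plaq (F.P (K₀ + 1)) 0 =>
          Site.tdist q.src (emb y) ≤ 2 * (F.P (K₀ + 1)).d * (F.P (K₀ + 1)).L + (F.P (K₀ + 1)).L),
          (dist1 (GaugeField.plaqHol W q) ^ 2 + dist1 (GaugeField.plaqHol Y q) ^ 2) =
          ∑ q ∈ univ.filter (fun q : Plaq (F.P (K₀ + 1)) 0 =>
          Site.tdist q.src (emb y) ≤ 2 * (F.P (K₀ + 1)).d * (F.P (K₀ + 1)).L + (F.P (K₀ + 1)).L),
          (dist1 (GaugeField.plaqHol U q) ^ 2 + dist1 (GaugeField.plaqHol Z q) ^ 2) := by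
        rw [Finset.sum_add_distrib, Finset.sum_add_distrib, hW, sum_ball_gaugeAct, hY, sum_ball_gaugeAct]
      rw [heq]
      have hle := sum_ball_pair_le_of_plaqSmall U Z hUθ hZθ (emb y) (2 * (F.P (K₀ + 1)).d * (F.P (K₀ + 1)).L + (F.P (K₀ + 1)).L)
      have hsq : Real.sqrt (∑ q ∈ univ.filter (fun q : Plaq (F.P (K₀ + 1)) 0 =>
          Site.tdist q.src (emb y) ≤ 2 * (F.P (K₀ + 1)).d * (F.P (K₀ + 1)).L + (F.P (K₀ + 1)).L),
          (dist1 (GaugeField.plaqHol U q) ^ 2 + dist1 (GaugeField.plaqHol Z q) ^ 2)) ≤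
          Real.sqrt (2 * ((((F.P (K₀ + 1)).d ^ 2 * (2 * (2 * (F.P (K₀ + 1)).d * (F.P (K₀ + 1)).L + (F.P (K₀ + 1)).L) + 1) ^ (F.P (K₀ + 1)).d : ℕ) : ℝ))) * θ := by
        rw [← Real.sqrt_sq hθ0, ← Real.sqrt_mul (by positivity)]
        exact Real.sqrt_le_sqrt hle
      exact hsq.trans_lt (hθ1 (K₀ + 1))
    have hpair := sum_dist1_mul_inv_sq_le hk W Y haxW hT
    rw [hd, hL] at hpair
    -- the mismatch channel = the coarse pair deviation; the plaquette channel = 4·(A U + A Z)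
    have havgW : avgFun ℰp W = avgFun ℰp U := by
      rw [← blockAvg_avg, hW, (BlockAveraging.blockAvg (P := F.P (K₀ + 1)) (j := 0) ℰp).covariant hk v U, hvemb]
      exact B12RTGaugeInvariance254.gaugeAct_one' _
    have havgY : avgFun ℰp Y = GaugeField.gaugeAct (fun y : Site (F.P (K₀ + 1)) 1 => w' ((siteShift h).symm y)) (avgFun ℰp Z) := by
      rw [← blockAvg_avg, hY, (BlockAveraging.blockAvg (P := F.P (K₀ + 1)) (j := 0) ℰp).covariant hk g Z, hgemb, blockAvg_avg]
      rfl
    have hmis : ∑ c : PBond (F.P (K₀ + 1)) 1, dist1 (avgFun ℰp W c * (avgFun ℰp Y c)⁻¹) ^ 2 ≤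
        8 * ((2 * (((3 : ℕ) : ℝ) * (F.L : ℝ)) ^ 2 + 2 * (6 * ((((3 + 2) * F.L : ℕ) : ℝ) ^ 2 / 4)) + ((3 * ((F.L - 1) / 2) : ℕ) : ℝ) * (4 * (((3 : ℕ) : ℝ) * (F.L : ℝ)) ^ 2 + 2)) ^ 2 * ((3 * (2 * (2 * 3 * F.L + F.L + 3 * F.L) + 1) ^ 3 : ℕ) : ℝ)) * (2 * ((3 * (2 * (3 * F.L) + 1) ^ 3 : ℕ) : ℝ) * (((2 : ℕ) : ℝ) * (((F.L : ℝ) ^ 2 + 6 * (((3 + 2) * F.L : ℕ) : ℝ) ^ 2) ^ 2 * ((3 ^ 2 * (2 * 3 + 1) ^ 3 : ℕ) : ℝ))) + 1) ^ m * (wilsonAction4 Ud + wilsonAction4 Zd) := by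
      rw [havgW, havgY, sum_sq_mismatch_pair_eq F K₀ U Z w']
      exact hsum'
    have hplaq : ∑ q : Plaq (F.P (K₀ + 1)) 0, (dist1 (GaugeField.plaqHol W q) ^ 2 + dist1 (GaugeField.plaqHol Y q) ^ 2) ≤
        4 * (wilsonAction4 U + wilsonAction4 Z) := by
      have h1 : ∑ q : Plaq (F.P (K₀ + 1)) 0, (dist1 (GaugeField.plaqHol W q) ^ 2 + dist1 (GaugeField.plaqHol Y q) ^ 2) =
          ∑ q : Plaq (F.P (K₀ + 1)) 0, dist1 (GaugeField.plaqHol U q) ^ 2 + ∑ q : Plaq (F.P (K₀ + 1)) 0, dist1 (GaugeField.plaqHol Z q) ^ 2 := by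
        have e1 : ∑ q : Plaq (F.P (K₀ + 1)) 0, dist1 (GaugeField.plaqHol W q) ^ 2 = ∑ q : Plaq (F.P (K₀ + 1)) 0, dist1 (GaugeField.plaqHol U q) ^ 2 :=
          Finset.sum_congr rfl fun q _ => by rw [hW, T4WilsonGaugeFlatDirection.plaqHol_gaugeAct, GaugeGroup.dist1_conj]
        have e2 : ∑ q : Plaq (F.P (K₀ + 1)) 0, dist1 (GaugeField.plaqHol Y q) ^ 2 = ∑ q : Plaq (F.P (K₀ + 1)) 0, dist1 (GaugeField.plaqHol Z q) ^ 2 :=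
          Finset.sum_congr rfl fun q _ => by rw [hY, T4WilsonGaugeFlatDirection.plaqHol_gaugeAct, GaugeGroup.dist1_conj]
        rw [Finset.sum_add_distrib, e1, e2]
      rw [h1]
      have hU4 := sum_dist1_sq_plaq_le_four_mul_wilsonAction4 U
      have hZ4 := sum_dist1_sq_plaq_le_four_mul_wilsonAction4 Z
      linarith
    -- the descended actions
    have havgA : ∀ X : GaugeField (F.P (K₀ + 1)) 0 (Matrix.specialUnitaryGroup (Fin 2) ℂ), PlaqSmall θ X →
        wilsonAction4 (descendTo F ℰp K₀ (K₀ + 1) (Nat.le_succ K₀) X) ≤ (((2 : ℕ) : ℝ) * (((F.L : ℝ) ^ 2 + 6 * (((3 + 2) * F.L : ℕ) : ℝ) ^ 2) ^ 2 * ((3 ^ 2 * (2 * 3 + 1) ^ 3 : ℕ) : ℝ))) * wilsonAction4 X := by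
      intro X hXθ
      have hT2 : ∀ p : Plaq (F.P (K₀ + 1)) (0 + 1), Real.sqrt (∑ q ∈ univ.filter (fun q : Plaq (F.P (K₀ + 1)) 0 =>
          ∀ κ, blockOf q.src κ = p.src κ ∨ blockOf q.src κ = p.src κ + 1 ∨ blockOf q.src κ = p.src κ - 1), dist1 (GaugeField.plaqHol X q) ^ 2) <
          deltaSU (Fin 2) / (((((F.P (K₀ + 1)).d + 2) * (F.P (K₀ + 1)).L : ℕ) : ℝ) ^ 2 / 4) := by
        intro p
        have hle := sum_near_le_of_plaqSmall hk X hXθ p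
        have hsq : Real.sqrt (∑ q ∈ univ.filter (fun q : Plaq (F.P (K₀ + 1)) 0 =>
            ∀ κ, blockOf q.src κ = p.src κ ∨ blockOf q.src κ = p.src κ + 1 ∨ blockOf q.src κ = p.src κ - 1), dist1 (GaugeField.plaqHol X q) ^ 2) ≤
            Real.sqrt ((((F.P (K₀ + 1)).d ^ 2 * (2 * ((F.P (K₀ + 1)).d * (F.P (K₀ + 1)).L) + 1) ^ (F.P (K₀ + 1)).d *
              (2 * (F.P (K₀ + 1)).d + 1) ^ (F.P (K₀ + 1)).d : ℕ) : ℝ)) * θ := by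
          rw [← Real.sqrt_sq hθ0, ← Real.sqrt_mul (Nat.cast_nonneg _)]
          exact Real.sqrt_le_sqrt hle
        exact hsq.trans_lt (hθ2 (K₀ + 1))
      have h1 := wilsonAction4_avg_le (N := 2) hk X hT2
      rw [hd, hL] at h1
      rw [descendTo_succ]
      exact (wilsonAction4_fieldShift _ _).trans_le h1
    have hA' : wilsonAction4 Ud + wilsonAction4 Zd ≤ (((2 : ℕ) : ℝ) * (((F.L : ℝ) ^ 2 + 6 * (((3 + 2) * F.L : ℕ) : ℝ) ^ 2) ^ 2 * ((3 ^ 2 * (2 * 3 + 1) ^ 3 : ℕ) : ℝ))) * (wilsonAction4 U + wilsonAction4 Z) := by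
      have h1 := havgA U hUθ
      have h2 := havgA Z hZθ
      exact (add_le_add h1 h2).trans_eq (mul_add _ _ _).symm
    -- the transformation `w := v⁻¹·g`
    refine ⟨fun x => (v x)⁻¹ * g x, ?_, ?_⟩
    · intro U''
      have hwemb : (fun y : Site (F.P (K₀ + 1)) 1 => (v (emb y))⁻¹ * g (emb y)) = fun y => w' ((siteShift h).symm y) := by
        funext y
        rw [show v (emb y) = 1 from hv1 y, inv_one, one_mul]
        exact congrFun hgemb y
      have hcov : (BlockAveraging.blockAvg (P := F.P (K₀ + 1)) (j := 0) ℰp).avg (GaugeField.gaugeAct (fun x => (v x)⁻¹ * g x) U'') =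
          GaugeField.gaugeAct (fun y : Site (F.P (K₀ + 1)) 1 => w' ((siteShift h).symm y))
            ((BlockAveraging.blockAvg (P := F.P (K₀ + 1)) (j := 0) ℰp).avg U'') := by
        have hc := (BlockAveraging.blockAvg (P := F.P (K₀ + 1)) (j := 0) ℰp).covariant hk (fun x => (v x)⁻¹ * g x) U''
        rw [hc]
        exact congrArg (fun u => GaugeField.gaugeAct u ((BlockAveraging.blockAvg (P := F.P (K₀ + 1)) (j := 0) ℰp).avg U'')) hwemb
      have hstep : descendTo F ℰp K₀ (K₀ + 1) (Nat.le_succ K₀) (GaugeField.gaugeAct (fun x => (v x)⁻¹ * g x) U'') =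
          GaugeField.gaugeAct w' (descendTo F ℰp K₀ (K₀ + 1) (Nat.le_succ K₀) U'') := by
        rw [descendTo_succ, descendTo_succ]
        exact ((congrArg (fieldShift _) hcov).trans (gaugeAct_fieldShift _ w' _).symm)
      calc descendTo F ℰp J (K₀ + 1) hJK (GaugeField.gaugeAct (fun x => (v x)⁻¹ * g x) U'')
          = descendTo F ℰp J K₀ hJK₀ (descendTo F ℰp K₀ (K₀ + 1) (Nat.le_succ K₀) (GaugeField.gaugeAct (fun x => (v x)⁻¹ * g x) U'')) := by
            rw [descendTo_descendTo]
        _ = descendTo F ℰp J K₀ hJK₀ (GaugeField.gaugeAct w' (descendTo F ℰp K₀ (K₀ + 1) (Nat.le_succ K₀) U'')) := by rw [hstep]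
        _ = descendTo F ℰp J K₀ hJK₀ (descendTo F ℰp K₀ (K₀ + 1) (Nat.le_succ K₀) U'') := hres' _
        _ = descendTo F ℰp J (K₀ + 1) hJK U'' := by rw [descendTo_descendTo]
    · have hconj : ∀ ℓ : PBond (F.P (K₀ + 1)) 0,
          dist1 (U ℓ * ((GaugeField.gaugeAct (fun x => (v x)⁻¹ * g x) Z) ℓ)⁻¹) = dist1 (W ℓ * (Y ℓ)⁻¹) := by
        intro ℓ
        have e : U ℓ * ((GaugeField.gaugeAct (fun x => (v x)⁻¹ * g x) Z) ℓ)⁻¹ = (v ℓ.src)⁻¹ * (W ℓ * (Y ℓ)⁻¹) * ((v ℓ.src)⁻¹)⁻¹ := by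
          rw [hW, hY]
          show U ℓ * ((v ℓ.src)⁻¹ * g ℓ.src * Z ℓ * ((v ℓ.tgt)⁻¹ * g ℓ.tgt)⁻¹)⁻¹ =
            (v ℓ.src)⁻¹ * ((v ℓ.src * U ℓ * (v ℓ.tgt)⁻¹) * (g ℓ.src * Z ℓ * (g ℓ.tgt)⁻¹)⁻¹) * ((v ℓ.src)⁻¹)⁻¹
          group
        rw [e, GaugeGroup.dist1_conj]
      rw [Finset.sum_congr rfl fun ℓ _ => by rw [hconj ℓ]]
      have hA0 : 0 ≤ wilsonAction4 U + wilsonAction4 Z := add_nonneg (wilsonAction4_nonneg U) (wilsonAction4_nonneg Z)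
      have hCsq0 : (0 : ℝ) ≤ (2 * (((3 : ℕ) : ℝ) * (F.L : ℝ)) ^ 2 + 2 * (6 * ((((3 + 2) * F.L : ℕ) : ℝ) ^ 2 / 4)) + ((3 * ((F.L - 1) / 2) : ℕ) : ℝ) * (4 * (((3 : ℕ) : ℝ) * (F.L : ℝ)) ^ 2 + 2)) ^ 2 := by positivity
      have hMr0 : (0 : ℝ) ≤ ((3 * (2 * (2 * 3 * F.L + F.L + 3 * F.L) + 1) ^ 3 : ℕ) : ℝ) := Nat.cast_nonneg _
      have hNBr0 : (0 : ℝ) ≤ ((3 * (2 * (3 * F.L) + 1) ^ 3 : ℕ) : ℝ) := Nat.cast_nonneg _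
      have hcA0 : (0 : ℝ) ≤ ((2 : ℕ) : ℝ) * (((F.L : ℝ) ^ 2 + 6 * (((3 + 2) * F.L : ℕ) : ℝ) ^ 2) ^ 2 * ((3 ^ 2 * (2 * 3 + 1) ^ 3 : ℕ) : ℝ)) :=
        mul_nonneg (Nat.cast_nonneg _) (mul_nonneg (sq_nonneg _) (Nat.cast_nonneg _))
      exact step_arith m hCsq0 hMr0 hNBr0 hcA0 hA0 hpair hmis hplaq hA'

end Summit.QuantumFields.YangMills.Theorems.FluctuationComparisonRegPrIntLS2BetaClosePairL2Tower

end
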